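import Mathlib.MeasureTheory.Measure.Tilted
import Mathlib.Probability.Moments.Covariance
import Mathlib.Analysis.Calculus.ParametricIntegral
import Mathlib.Analysis.Calculus.Deriv.Slope
import Mathlib.Analysis.Calculus.Deriv.Mul
import Mathlib.Analysis.Calculus.Deriv.Inv
import Mathlib.Analysis.SpecialFunctions.ExpDeriv
import HarnessLib

/-!
# Crux `NT` (stmt-QuantumFields-19353): skew response, I — exponential tilting of a probability measure:
# the third cumulant is the derivative of the covariance (`κ₃ = ∂ₜ Covₜ`), generic layer

Helper file (`--supports stmt-QuantumFields-19353`) of the fleet lead prover of crux `NT` (unit `ym-spine-19353-p1`,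
g5).  It lands, in Mathlib vocabulary (`MeasureTheory.Measure.tilted`), the generic §1 of the crux idea
`Cruxes/NT/Ideas/skewness-from-asymptotic-freedom.md` (ym-cruxidea-19353-2, HOME sketch `SkewResponse.lean` rev 2,
farm-checked there): for bounded measurable `Z, W, X, Y` on a finite (resp. probability) measure space and the
exponentially tilted family `μₜ = μ.tilted (t·Z)` (density `e^{tZ}/∫e^{tZ}`),

* `hasDerivAt_integral_mul_exp` — `d/dt ∫ W e^{tZ} dμ = ∫ W Z e^{tZ} dμ` (dominated differentiation);
* `integral_tilted_eq_div` — `∫ W dμₜ = (∫ W e^{tZ} dμ) / (∫ e^{tZ} dμ)`;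
* `hasDerivAt_integral_tilted` — `d/dt Eₜ[W] = Eₜ[W Z] − Eₜ[W] Eₜ[Z] = Covₜ(W, Z)`;
* `hasDerivAt_cov_tilted` — **`d/dt Covₜ(X, Y) = κ₃,ₜ(X, Y, Z)`** (the explicit five-term third cumulant, the shape of
  the tree's `torusK3` / `kerK3`), `hasDerivAt_cov_tilted_zero` (at `t = 0`, plain expectations under `μ`), and the
  same with Mathlib's `ProbabilityTheory.covariance`: `hasDerivAt_covariance_tilted`;
* `k3_sum_third` — linearity of the explicit third cumulant in its third slot over a `Finset`;
* `deriv_le_of_increment_le` / `le_deriv_of_le_increment` — one-sided slope lemmas at `0`.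

File II (`…NTSkewResponse.lean`) specialises `μ` to Wilson's measure on an odd torus and `Z` to a smeared action
density, giving `Q3 = d/dt|₀ Q2` under a local modulation of the coupling.  Nothing here is specific to gauge
theory; no definition is introduced (the tilted family is Mathlib's).

Refs: card `Cruxes/NT/Ideas/skewness-from-asymptotic-freedom.md` §Mechanism 1; exponential families / cumulants as
derivatives of the log-Laplace transform (folklore).
-/

set_option autoImplicit false

noncomputable section

open MeasureTheory ProbabilityTheory Filter Topology

namespace Summit.QuantumFields.YangMills.Cruxes.NT.SkewResponse

variable {Ω : Type*} [MeasurableSpace Ω] {μ : Measure Ω}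

/-! ## Bounded measurable data: integrability and the derivative of `∫ W e^{tZ}` -/

section Num

variable {Z W X Y : Ω → ℝ} {MZ MW MX MY : ℝ}

omit [MeasurableSpace Ω] in
/-- Pointwise bound `|W e^{tZ}| ≤ M_W e^{T M_Z}` for `|t| ≤ T`. [folklore] -/
theorem abs_mul_exp_le (hZb : ∀ ω, |Z ω| ≤ MZ) (hWb : ∀ ω, |W ω| ≤ MW) {T t : ℝ} (ht : |t| ≤ T)
    (ω : Ω) : |W ω * Real.exp (t * Z ω)| ≤ MW * Real.exp (T * MZ) := by
  rw [abs_mul, Real.abs_exp]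
  have hMW : 0 ≤ MW := (abs_nonneg _).trans (hWb ω)
  refine mul_le_mul (hWb ω) (Real.exp_le_exp.2 ?_) (Real.exp_nonneg _) hMW
  calc t * Z ω ≤ |t * Z ω| := le_abs_self _
    _ = |t| * |Z ω| := abs_mul _ _
    _ ≤ T * MZ := mul_le_mul ht (hZb ω) (abs_nonneg _) ((abs_nonneg t).trans ht)

omit [MeasurableSpace Ω] in
/-- Pointwise bound for a product of two bounded functions. [folklore] -/
theorem abs_mul_le_mul (hXb : ∀ ω, |X ω| ≤ MX) (hYb : ∀ ω, |Y ω| ≤ MY) (ω : Ω) :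
    |X ω * Y ω| ≤ MX * MY := by
  rw [abs_mul]; exact mul_le_mul (hXb ω) (hYb ω) (abs_nonneg _) ((abs_nonneg _).trans (hXb ω))

/-- Measurability of `W e^{tZ}`. [folklore] -/
theorem measurable_mul_exp (hZ : Measurable Z) (hW : Measurable W) (t : ℝ) :
    Measurable fun ω => W ω * Real.exp (t * Z ω) :=
  hW.mul ((measurable_const.mul hZ).exp)

/-- Integrability of `W e^{tZ}` for bounded measurable data and a finite measure. [folklore] -/
theorem integrable_mul_exp [IsFiniteMeasure μ] (hZ : Measurable Z) (hW : Measurable W)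
    (hZb : ∀ ω, |Z ω| ≤ MZ) (hWb : ∀ ω, |W ω| ≤ MW) (t : ℝ) :
    Integrable (fun ω => W ω * Real.exp (t * Z ω)) μ :=
  Integrable.of_bound (measurable_mul_exp hZ hW t).aestronglyMeasurable (MW * Real.exp (|t| * MZ))
    (ae_of_all _ fun ω => by rw [Real.norm_eq_abs]; exact abs_mul_exp_le hZb hWb le_rfl ω)

/-- Integrability of `e^{tZ}` for bounded measurable `Z` and a finite measure. [folklore] -/
theorem integrable_exp_mul [IsFiniteMeasure μ] (hZ : Measurable Z) (hZb : ∀ ω, |Z ω| ≤ MZ) (t : ℝ) :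
    Integrable (fun ω => Real.exp (t * Z ω)) μ := by
  have h := integrable_mul_exp (μ := μ) hZ measurable_const hZb (W := fun _ => (1 : ℝ)) (MW := 1)
    (fun _ => by simp) t
  simpa using h

/-- **`d/dt ∫ W e^{tZ} dμ = ∫ W Z e^{tZ} dμ`** (dominated differentiation under the integral sign; everything
bounded, `μ` finite). [folklore] -/
theorem hasDerivAt_integral_mul_exp [IsFiniteMeasure μ] (hZ : Measurable Z) (hW : Measurable W)
    (hZb : ∀ ω, |Z ω| ≤ MZ) (hWb : ∀ ω, |W ω| ≤ MW) (t₀ : ℝ) :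
    HasDerivAt (fun t => ∫ ω, W ω * Real.exp (t * Z ω) ∂μ)
      (∫ ω, W ω * Z ω * Real.exp (t₀ * Z ω) ∂μ) t₀ := by
  have key := hasDerivAt_integral_of_dominated_loc_of_deriv_le (μ := μ)
    (F := fun t ω => W ω * Real.exp (t * Z ω))
    (F' := fun t ω => W ω * (Real.exp (t * Z ω) * Z ω)) (x₀ := t₀) (s := Metric.ball t₀ 1)
    (bound := fun _ => MW * (Real.exp ((|t₀| + 1) * MZ) * MZ))
    (Metric.ball_mem_nhds t₀ one_pos)
    (Eventually.of_forall fun t => (measurable_mul_exp hZ hW t).aestronglyMeasurable)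
    (integrable_mul_exp hZ hW hZb hWb t₀)
    ((hW.mul (((measurable_const.mul hZ).exp).mul hZ)).aestronglyMeasurable)
    (ae_of_all _ fun ω t ht => by
      have ht' : |t| ≤ |t₀| + 1 := by
        have : dist t t₀ < 1 := Metric.mem_ball.1 ht
        rw [Real.dist_eq] at this
        calc |t| = |t₀ + (t - t₀)| := by ring_nf
          _ ≤ |t₀| + |t - t₀| := abs_add_le _ _
          _ ≤ |t₀| + 1 := by linarith
      have hMW : 0 ≤ MW := (abs_nonneg _).trans (hWb ω)
      rw [norm_mul, Real.norm_eq_abs, norm_mul, Real.norm_eq_abs, Real.norm_eq_abs, Real.abs_exp]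
      refine mul_le_mul (hWb ω) ?_ (by positivity) hMW
      refine mul_le_mul (Real.exp_le_exp.2 ?_) (hZb ω) (abs_nonneg _) (Real.exp_nonneg _)
      calc t * Z ω ≤ |t * Z ω| := le_abs_self _
        _ = |t| * |Z ω| := abs_mul _ _
        _ ≤ (|t₀| + 1) * MZ := mul_le_mul ht' (hZb ω) (abs_nonneg _) (by positivity))
    (integrable_const _)
    (ae_of_all _ fun ω t _ => by
      have h1 : HasDerivAt (fun t : ℝ => t * Z ω) (Z ω) t := by
        simpa using (hasDerivAt_id t).mul_const (Z ω)
      exact (h1.exp).const_mul (W ω))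
  simpa [mul_assoc, mul_comm (Z _) (Real.exp _)] using key.2

end Num

/-! ## The tilted family `μₜ = μ.tilted (t·Z)`: expectations as quotients, their derivatives -/

section Tilted

variable {Z W X Y : Ω → ℝ} {MZ MW MX MY : ℝ}

/-- `∫ W d(μ.tilted f) = (∫ W e^{f} dμ) / (∫ e^{f} dμ)` — the tilted expectation as a quotient of un-normalised
exponential moments (Mathlib's `integral_tilted`, constant pulled out). [folklore] -/
theorem integral_tilted_eq_div (f W : Ω → ℝ) :
    ∫ ω, W ω ∂(μ.tilted f) = (∫ ω, W ω * Real.exp (f ω) ∂μ) / (∫ ω, Real.exp (f ω) ∂μ) := by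
  rw [integral_tilted]
  simp_rw [smul_eq_mul]
  have : ∀ ω, Real.exp (f ω) / (∫ ω, Real.exp (f ω) ∂μ) * W ω =
      (∫ ω, Real.exp (f ω) ∂μ)⁻¹ * (W ω * Real.exp (f ω)) := fun ω => by ring
  simp_rw [this, integral_const_mul]
  ring

/-- The normalising exponential moment is positive (`μ ≠ 0`, `Z` bounded measurable). [folklore] -/
theorem integral_exp_mul_pos [IsFiniteMeasure μ] [NeZero μ] (hZ : Measurable Z) (hZb : ∀ ω, |Z ω| ≤ MZ)
    (t : ℝ) : 0 < ∫ ω, Real.exp (t * Z ω) ∂μ :=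
  integral_exp_pos (integrable_exp_mul hZ hZb t)

/-- **`d/dt Eₜ[W] = Eₜ[W Z] − Eₜ[W]·Eₜ[Z]`** (`= Covₜ(W, Z)`) along the tilted family `μₜ = μ.tilted (t·Z)`, at every
`t₀`, for bounded measurable `Z, W` on a finite non-zero measure space. [folklore] -/
theorem hasDerivAt_integral_tilted [IsFiniteMeasure μ] [NeZero μ] (hZ : Measurable Z) (hW : Measurable W)
    (hZb : ∀ ω, |Z ω| ≤ MZ) (hWb : ∀ ω, |W ω| ≤ MW) (t₀ : ℝ) :
    HasDerivAt (fun t => ∫ ω, W ω ∂(μ.tilted fun ω => t * Z ω))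
      ((∫ ω, W ω * Z ω ∂(μ.tilted fun ω => t₀ * Z ω)) -
        (∫ ω, W ω ∂(μ.tilted fun ω => t₀ * Z ω)) * (∫ ω, Z ω ∂(μ.tilted fun ω => t₀ * Z ω))) t₀ := by
  have hN := hasDerivAt_integral_mul_exp (μ := μ) hZ hW hZb hWb t₀
  have hD' := hasDerivAt_integral_mul_exp (μ := μ) hZ measurable_const hZb (MW := 1) (W := fun _ => 1)
    (fun ω => by simp) t₀
  have hD : HasDerivAt (fun t => ∫ ω, Real.exp (t * Z ω) ∂μ) (∫ ω, Z ω * Real.exp (t₀ * Z ω) ∂μ) t₀ := by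
    have e1 : (fun t => ∫ ω, (1 : ℝ) * Real.exp (t * Z ω) ∂μ) = fun t => ∫ ω, Real.exp (t * Z ω) ∂μ := by
      funext t; simp
    have e2 : (∫ ω, (1 : ℝ) * Z ω * Real.exp (t₀ * Z ω) ∂μ) = ∫ ω, Z ω * Real.exp (t₀ * Z ω) ∂μ := by simp
    rw [e1, e2] at hD'
    exact hD'
  have hDne : (∫ ω, Real.exp (t₀ * Z ω) ∂μ) ≠ 0 := (integral_exp_mul_pos hZ hZb t₀).ne'
  have key := hN.div hD hDne
  have efun : (fun t => ∫ ω, W ω ∂(μ.tilted fun ω => t * Z ω)) =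
      fun t => (∫ ω, W ω * Real.exp (t * Z ω) ∂μ) / (∫ ω, Real.exp (t * Z ω) ∂μ) := by
    funext t; exact integral_tilted_eq_div _ _
  rw [efun]
  refine key.congr_deriv ?_
  rw [integral_tilted_eq_div, integral_tilted_eq_div, integral_tilted_eq_div]
  have eWZ : (∫ ω, W ω * Z ω * Real.exp (t₀ * Z ω) ∂μ) = ∫ ω, (W ω * Z ω) * Real.exp (t₀ * Z ω) ∂μ := rfl
  generalize (∫ ω, W ω * Z ω * Real.exp (t₀ * Z ω) ∂μ) = A at *
  generalize (∫ ω, W ω * Real.exp (t₀ * Z ω) ∂μ) = B at *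
  generalize (∫ ω, Z ω * Real.exp (t₀ * Z ω) ∂μ) = C at *
  generalize (∫ ω, Real.exp (t₀ * Z ω) ∂μ) = D at *
  field_simp

/-- **Third cumulant = linear response of the covariance to tilting.**  Along `μₜ = μ.tilted (t·Z)`,
`d/dt (Eₜ[XY] − Eₜ[X]Eₜ[Y]) = Eₜ[XYZ] − Eₜ[X]Eₜ[YZ] − Eₜ[Y]Eₜ[XZ] − Eₜ[Z]Eₜ[XY] + 2Eₜ[X]Eₜ[Y]Eₜ[Z]` at every `t₀`
(bounded measurable `X, Y, Z`; finite non-zero `μ`). [folklore] -/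
theorem hasDerivAt_cov_tilted [IsFiniteMeasure μ] [NeZero μ] (hZ : Measurable Z) (hX : Measurable X)
    (hY : Measurable Y) (hZb : ∀ ω, |Z ω| ≤ MZ) (hXb : ∀ ω, |X ω| ≤ MX) (hYb : ∀ ω, |Y ω| ≤ MY) (t₀ : ℝ) :
    HasDerivAt (fun t => (∫ ω, X ω * Y ω ∂(μ.tilted fun ω => t * Z ω)) -
        (∫ ω, X ω ∂(μ.tilted fun ω => t * Z ω)) * (∫ ω, Y ω ∂(μ.tilted fun ω => t * Z ω)))
      ((∫ ω, X ω * Y ω * Z ω ∂(μ.tilted fun ω => t₀ * Z ω))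
        - (∫ ω, X ω ∂(μ.tilted fun ω => t₀ * Z ω)) * (∫ ω, Y ω * Z ω ∂(μ.tilted fun ω => t₀ * Z ω))
        - (∫ ω, Y ω ∂(μ.tilted fun ω => t₀ * Z ω)) * (∫ ω, X ω * Z ω ∂(μ.tilted fun ω => t₀ * Z ω))
        - (∫ ω, Z ω ∂(μ.tilted fun ω => t₀ * Z ω)) * (∫ ω, X ω * Y ω ∂(μ.tilted fun ω => t₀ * Z ω))
        + 2 * ((∫ ω, X ω ∂(μ.tilted fun ω => t₀ * Z ω)) * (∫ ω, Y ω ∂(μ.tilted fun ω => t₀ * Z ω)) *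
            (∫ ω, Z ω ∂(μ.tilted fun ω => t₀ * Z ω)))) t₀ := by
  have hXY := hasDerivAt_integral_tilted (μ := μ) (W := fun ω => X ω * Y ω) hZ (hX.mul hY) hZb
    (abs_mul_le_mul hXb hYb) t₀
  have hX' := hasDerivAt_integral_tilted (μ := μ) hZ hX hZb hXb t₀
  have hY' := hasDerivAt_integral_tilted (μ := μ) hZ hY hZb hYb t₀
  have key := hXY.sub (hX'.mul hY')
  refine key.congr_deriv ?_
  ring

/-- `μ.tilted (0·Z) = μ` for a probability measure. [folklore] -/
theorem tilted_zero_mul [IsProbabilityMeasure μ] (Z : Ω → ℝ) : (μ.tilted fun ω => (0 : ℝ) * Z ω) = μ := by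
  simp

/-- **At `t = 0`**: `d/dt|₀ Cov_{μ.tilted (tZ)}(X, Y) = κ₃(X, Y, Z)` with plain expectations under the probability
measure `μ`. [folklore] -/
theorem hasDerivAt_cov_tilted_zero [IsProbabilityMeasure μ] (hZ : Measurable Z) (hX : Measurable X)
    (hY : Measurable Y) (hZb : ∀ ω, |Z ω| ≤ MZ) (hXb : ∀ ω, |X ω| ≤ MX) (hYb : ∀ ω, |Y ω| ≤ MY) :
    HasDerivAt (fun t => (∫ ω, X ω * Y ω ∂(μ.tilted fun ω => t * Z ω)) -
        (∫ ω, X ω ∂(μ.tilted fun ω => t * Z ω)) * (∫ ω, Y ω ∂(μ.tilted fun ω => t * Z ω)))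
      ((∫ ω, X ω * Y ω * Z ω ∂μ) - (∫ ω, X ω ∂μ) * (∫ ω, Y ω * Z ω ∂μ)
        - (∫ ω, Y ω ∂μ) * (∫ ω, X ω * Z ω ∂μ) - (∫ ω, Z ω ∂μ) * (∫ ω, X ω * Y ω ∂μ)
        + 2 * ((∫ ω, X ω ∂μ) * (∫ ω, Y ω ∂μ) * (∫ ω, Z ω ∂μ))) 0 := by
  have := hasDerivAt_cov_tilted (μ := μ) hZ hX hY hZb hXb hYb 0
  simpa only [tilted_zero_mul] using this

/-- The value at `t = 0` of the tilted covariance is the plain covariance `E[XY] − E[X]E[Y]`. [folklore] -/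
theorem cov_tilted_zero [IsProbabilityMeasure μ] (Z X Y : Ω → ℝ) :
    (∫ ω, X ω * Y ω ∂(μ.tilted fun ω => (0 : ℝ) * Z ω)) -
        (∫ ω, X ω ∂(μ.tilted fun ω => (0 : ℝ) * Z ω)) * (∫ ω, Y ω ∂(μ.tilted fun ω => (0 : ℝ) * Z ω)) =
      (∫ ω, X ω * Y ω ∂μ) - (∫ ω, X ω ∂μ) * (∫ ω, Y ω ∂μ) := by
  rw [tilted_zero_mul]

/-- Bounded measurable functions are in `L²` of every tilt (a finite measure). [folklore] -/
theorem memLp_two_tilted (Z : Ω → ℝ) (hX : Measurable X) (hXb : ∀ ω, |X ω| ≤ MX) (t : ℝ) :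
    MemLp X 2 (μ.tilted fun ω => t * Z ω) :=
  MemLp.of_bound hX.aestronglyMeasurable MX (ae_of_all _ fun ω => by simpa using hXb ω)

/-- Mathlib's covariance under the tilted measure is the explicit `Eₜ[XY] − Eₜ[X]Eₜ[Y]` (bounded data). [folklore] -/
theorem covariance_tilted_eq [IsProbabilityMeasure μ] (hZ : Measurable Z) (hZb : ∀ ω, |Z ω| ≤ MZ)
    (hX : Measurable X) (hY : Measurable Y) (hXb : ∀ ω, |X ω| ≤ MX) (hYb : ∀ ω, |Y ω| ≤ MY) (t : ℝ) :
    cov[X, Y; μ.tilted fun ω => t * Z ω] =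
      (∫ ω, X ω * Y ω ∂(μ.tilted fun ω => t * Z ω)) -
        (∫ ω, X ω ∂(μ.tilted fun ω => t * Z ω)) * (∫ ω, Y ω ∂(μ.tilted fun ω => t * Z ω)) := by
  haveI : IsProbabilityMeasure (μ.tilted fun ω => t * Z ω) :=
    isProbabilityMeasure_tilted (integrable_exp_mul hZ hZb t)
  rw [covariance_eq_sub (memLp_two_tilted Z hX hXb t) (memLp_two_tilted Z hY hYb t)]
  rfl

/-- **`d/dt cov[X, Y; μ.tilted (t·Z)] = κ₃,ₜ(X, Y, Z)`** — `hasDerivAt_cov_tilted` in Mathlib's covariance vocabulary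
(probability measure `μ`, bounded measurable `X, Y, Z`). [folklore] -/
theorem hasDerivAt_covariance_tilted [IsProbabilityMeasure μ] (hZ : Measurable Z) (hX : Measurable X)
    (hY : Measurable Y) (hZb : ∀ ω, |Z ω| ≤ MZ) (hXb : ∀ ω, |X ω| ≤ MX) (hYb : ∀ ω, |Y ω| ≤ MY) (t₀ : ℝ) :
    HasDerivAt (fun t => cov[X, Y; μ.tilted fun ω => t * Z ω])
      ((∫ ω, X ω * Y ω * Z ω ∂(μ.tilted fun ω => t₀ * Z ω))
        - (∫ ω, X ω ∂(μ.tilted fun ω => t₀ * Z ω)) * (∫ ω, Y ω * Z ω ∂(μ.tilted fun ω => t₀ * Z ω))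
        - (∫ ω, Y ω ∂(μ.tilted fun ω => t₀ * Z ω)) * (∫ ω, X ω * Z ω ∂(μ.tilted fun ω => t₀ * Z ω))
        - (∫ ω, Z ω ∂(μ.tilted fun ω => t₀ * Z ω)) * (∫ ω, X ω * Y ω ∂(μ.tilted fun ω => t₀ * Z ω))
        + 2 * ((∫ ω, X ω ∂(μ.tilted fun ω => t₀ * Z ω)) * (∫ ω, Y ω ∂(μ.tilted fun ω => t₀ * Z ω)) *
            (∫ ω, Z ω ∂(μ.tilted fun ω => t₀ * Z ω)))) t₀ := by
  have e : (fun t => cov[X, Y; μ.tilted fun ω => t * Z ω]) = fun t =>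
      (∫ ω, X ω * Y ω ∂(μ.tilted fun ω => t * Z ω)) -
        (∫ ω, X ω ∂(μ.tilted fun ω => t * Z ω)) * (∫ ω, Y ω ∂(μ.tilted fun ω => t * Z ω)) :=
    funext fun t => covariance_tilted_eq hZ hZb hX hY hXb hYb t
  rw [e]
  exact hasDerivAt_cov_tilted hZ hX hY hZb hXb hYb t₀

end Tilted

/-! ## One-sided slope lemmas at `0` -/

section Slope

/-- A function with derivative `D` at `0` whose increments are `≤ c·t` on `(0, t₀]` has `D ≤ c`. [folklore] -/
theorem deriv_le_of_increment_le {φ : ℝ → ℝ} {D c t₀ : ℝ} (ht₀ : 0 < t₀) (hφ : HasDerivAt φ D 0)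
    (h : ∀ t, 0 < t → t ≤ t₀ → φ t - φ 0 ≤ c * t) : D ≤ c := by
  have hT := hφ.tendsto_slope_zero_right
  refine le_of_tendsto hT ?_
  filter_upwards [Ioc_mem_nhdsGT ht₀] with t ht
  rw [zero_add, smul_eq_mul]
  have ht0 : 0 < t := ht.1
  calc t⁻¹ * (φ t - φ 0) ≤ t⁻¹ * (c * t) :=
        mul_le_mul_of_nonneg_left (h t ht0 ht.2) (inv_nonneg.2 ht0.le)
    _ = c := by field_simp

/-- A function with derivative `D` at `0` whose increments are `≥ c·t` on `(0, t₀]` has `c ≤ D`. [folklore] -/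
theorem le_deriv_of_le_increment {φ : ℝ → ℝ} {D c t₀ : ℝ} (ht₀ : 0 < t₀) (hφ : HasDerivAt φ D 0)
    (h : ∀ t, 0 < t → t ≤ t₀ → c * t ≤ φ t - φ 0) : c ≤ D := by
  have hT := hφ.tendsto_slope_zero_right
  refine ge_of_tendsto hT ?_
  filter_upwards [Ioc_mem_nhdsGT ht₀] with t ht
  rw [zero_add, smul_eq_mul]
  have ht0 : 0 < t := ht.1
  calc c = t⁻¹ * (c * t) := by field_simp
    _ ≤ t⁻¹ * (φ t - φ 0) := mul_le_mul_of_nonneg_left (h t ht0 ht.2) (inv_nonneg.2 ht0.le)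

end Slope

/-! ## Linearity of the explicit third cumulant in its third slot -/

section Linear

variable [IsFiniteMeasure μ] {ι : Type*}

/-- `∫ W · (Σ cᵢ Dᵢ) = Σ cᵢ ∫ W Dᵢ` for bounded measurable data. [folklore] -/
theorem integral_mul_finset_sum (S : Finset ι) (c : ι → ℝ) {W : Ω → ℝ} {D : ι → Ω → ℝ}
    (hW : Measurable W) (hD : ∀ i, Measurable (D i)) {MW MD : ℝ} (hWb : ∀ ω, |W ω| ≤ MW)
    (hDb : ∀ i ω, |D i ω| ≤ MD) :
    ∫ ω, W ω * (∑ i ∈ S, c i * D i ω) ∂μ = ∑ i ∈ S, c i * ∫ ω, W ω * D i ω ∂μ := by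
  have hpt : ∀ ω, W ω * (∑ i ∈ S, c i * D i ω) = ∑ i ∈ S, c i * (W ω * D i ω) := fun ω => by
    rw [Finset.mul_sum]
    exact Finset.sum_congr rfl fun i _ => by ring
  simp_rw [hpt]
  refine (integral_finsetSum S fun i _ =>
    (Integrable.of_bound (μ := μ) ((hW.mul (hD i)).aestronglyMeasurable) (MW * MD)
      (ae_of_all _ fun ω => by rw [Real.norm_eq_abs]; exact abs_mul_le_mul hWb (hDb i) ω)).const_mul
        (c i)).trans ?_
  exact Finset.sum_congr rfl fun i _ => integral_const_mul _ _

/-- `∫ (Σ cᵢ Dᵢ) = Σ cᵢ ∫ Dᵢ` for bounded measurable data. [folklore] -/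
theorem integral_finset_sum_mul (S : Finset ι) (c : ι → ℝ) {D : ι → Ω → ℝ}
    (hD : ∀ i, Measurable (D i)) {MD : ℝ} (hDb : ∀ i ω, |D i ω| ≤ MD) :
    ∫ ω, (∑ i ∈ S, c i * D i ω) ∂μ = ∑ i ∈ S, c i * ∫ ω, D i ω ∂μ := by
  have := integral_mul_finset_sum (μ := μ) S c (W := fun _ => (1 : ℝ)) measurable_const hD (MW := 1)
    (fun _ => by simp) hDb
  simpa using this

/-- **`κ₃(X, Y, Σ cᵢ Dᵢ) = Σ cᵢ κ₃(X, Y, Dᵢ)`** for the explicit (plain-expectation) five-term third cumulant.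
[folklore] -/
theorem k3_sum_third (S : Finset ι) (c : ι → ℝ) {X Y : Ω → ℝ} {D : ι → Ω → ℝ}
    (hX : Measurable X) (hY : Measurable Y) (hD : ∀ i, Measurable (D i)) {MX MY MD : ℝ}
    (hXb : ∀ ω, |X ω| ≤ MX) (hYb : ∀ ω, |Y ω| ≤ MY) (hDb : ∀ i ω, |D i ω| ≤ MD) :
    (∫ ω, X ω * Y ω * (∑ i ∈ S, c i * D i ω) ∂μ)
      - (∫ ω, X ω ∂μ) * (∫ ω, Y ω * (∑ i ∈ S, c i * D i ω) ∂μ)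
      - (∫ ω, Y ω ∂μ) * (∫ ω, X ω * (∑ i ∈ S, c i * D i ω) ∂μ)
      - (∫ ω, (∑ i ∈ S, c i * D i ω) ∂μ) * (∫ ω, X ω * Y ω ∂μ)
      + 2 * ((∫ ω, X ω ∂μ) * (∫ ω, Y ω ∂μ) * (∫ ω, (∑ i ∈ S, c i * D i ω) ∂μ))
    = ∑ i ∈ S, c i * ((∫ ω, X ω * Y ω * D i ω ∂μ) - (∫ ω, X ω ∂μ) * (∫ ω, Y ω * D i ω ∂μ)
        - (∫ ω, Y ω ∂μ) * (∫ ω, X ω * D i ω ∂μ) - (∫ ω, D i ω ∂μ) * (∫ ω, X ω * Y ω ∂μ)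
        + 2 * ((∫ ω, X ω ∂μ) * (∫ ω, Y ω ∂μ) * (∫ ω, D i ω ∂μ))) := by
  rw [integral_mul_finset_sum S c (W := fun ω => X ω * Y ω) (hX.mul hY) hD (abs_mul_le_mul hXb hYb) hDb,
    integral_mul_finset_sum S c hY hD hYb hDb, integral_mul_finset_sum S c hX hD hXb hDb,
    integral_finset_sum_mul S c hD hDb]
  simp only [Finset.mul_sum, Finset.sum_mul, ← Finset.sum_sub_distrib, ← Finset.sum_add_distrib]
  exact Finset.sum_congr rfl fun i _ => by ring

end Linear

end Summit.QuantumFields.YangMills.Cruxes.NT.SkewResponse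

end
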